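import Summits.ResolutionOfSingularities.ResolutionOfSingularities.Theorems.MarkedTransferCampaignG1PnegaObligationF33
import Literature.AlgebraicGeometry.Hironaka2017.S08UnitMonomial.R052aStandardExpression
import Literature.AlgebraicGeometry.Hironaka2017.S09LLUED.R053StandardExpressionEps
import Literature.AlgebraicGeometry.Hironaka2017.S09LLUED.R053aSetupEq75
import Literature.AlgebraicGeometry.Hironaka2017.Lib.TopFrontierAPI
import Literature.RingTheory.MvPowerSeries.HasseDerivDiffOp
import HarnessLib

/-!
# [OURS · L1 G1 ℘nega-INTERFACE] Obligation **F3.3, RETYPED** («§9.3 `⊟(g,q) ⊂ ℘̃`») — `PnegaObligation.F33std`: the `H♭`-datum TIED TO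
# THE PAGE (exact Hasse family of the frame; `(α, β, γ₀, u₀)` read off a standard expression (76) of `ϵ(0)`; `x ∋ y`; §8.3 orders)
# res-D-plan-1 INTERFACE RULING — V4 FIELD LIST FINAL 2026-08-27T03:44:20Z (5) «F33 retype by 063 tying (n,x,α,β,γ₀) to the standard
# expression and excluding order-0 operators, per ref-b1»; OURS-DESK #89 lane B res-L1-ref-b1 PARTIAL 03:30:32Z + DIFF; res-adj-8 RULING
# part 2 03:44:42Z REPAIR MENU. Data-level typing by res-type-063 (author of `PnegaObligation.F33`, p489269); carried by res-L1-type-o2.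

CARRIER NOTE (res-L1-type-o2 g6): TYPED by res-type-063 (kernel author of `PnegaObligation.F33`; HOME draft `D/res-type-063/PnegaObligationF33Std.draft.lean` sha16 d48787c66d835859, DRAFT READY 2026-08-27T04:26:05Z) as the RETYPE of obligation F3.3 ordered by res-D-plan-1 V4 RULING 03:44:20Z (5) after lane B's PARTIAL on OURS-DESK #89 / res-adj-8's REPAIR MENU; carried summit-side VERBATIM (this note added). [OURS · L1 G1] replaces the role of the §9 slot «⊟(g,q) ⊂ ⊟(Ě) ⊂ ℘nega(Ě) ⊂ ℘̃(Ě)» (p.47 L1–L11) as a scored obligation; NOT a statement of the manuscript.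
HONEST FRAMING. Nothing here is a statement of H. Hironaka's manuscript *Resolution of singularities in positive characteristics*
(2017-03-23, [Hironaka2017], lit key `paper:url-3343fd9e678b`; every printed item is a CANDIDATE [claim: Hironaka2017, status:
under-review]). `F33std` is OURS: a scoring OBLIGATION a replacement candidate for `℘̃` must meet so that the §9 consumers of the
slot «`⊟(g,q) ⊂ ⊟(Ě) ⊂ ℘nega(Ě) ⊂ ℘̃(Ě)`» (p.47 L2, L7–L11; (83)(2) p.55; p.58 L7) can be served; asserted of no candidate. The
structure `HFlatDatum` only PACKAGES printed data (every field carries its locator); it claims nothing. AI typing, weaker than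
expert review; nothing here is progress on resolution of singularities in positive characteristic; no claim beyond the kernel.

## What changed relative to `PnegaObligation.F33` (p489269) — lane B's two defects, and the placement
1. OPERATORS. `F33` quantified over every family `D` with `IsDiffOpLE K |X| (D X)` (order bounded from ABOVE only: order-0 families
   admitted — `MarkedTransferCampaignG1PnegaObligationF33Order0` §1 shows this re-imports `P(q) ⊆ ⋂_a tilde P(−a)`). HERE `D X := ∂^{(X)}`
   IS the divided-power (Hasse) partial derivative of the frame `x` on the completion `K'[[x]]` (p.50 L17–L19 «The symbol ∂^X denotes
   the elementary differential operator of multi-index X with respect to a fixed parameters x in the sense of Eq.(8)»; row 055's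
   reading `U50_3` = tree `Literature.RingTheory.MvPowerSeries.hasseDeriv`; Def. 9.7 p.50 L26–L29 computes «in K[[x]]»): `hasseFamily`.
2. EXPONENTS / UNIT. `F33` had `α β γ₀ u₀ x y` as free binders. HERE they are READ OFF a standard expression of `ϵ(0)` in terms of
   `x` of depth `ℓ` (row 052a `S08UnitMonomial.StandardExpression`: §8.4 p.46 l.29–38, ranges `a_i < p`, `b_j < p^{e−1}`, coefficients
   «units or zero in ρ^ℓ(O)»): `α = TopFrontier.alpha`, `β = TopFrontier.beta`, `γ₀ = TopFrontier.gamma 0` (row 054, Eq. (76)/(77)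
   p.49), `u₀ = StdExpr76.u0` (row 053, p.49 L4/L11), with (76)(2) p.49 L15 «u₀ is a unit and α ≠ (0)»; `x` = THE variables of
   `K'[[x]]`, `y = x_{i₀}` («x ∋ y», p.48 L26; row 053a `Setup93.iy`); §8.3 (1)–(2) p.46 l.18–28 via row 052a `U46_3_ours`
   (`y^q = g − ϵ`, `ord g = q = p^e < ord ϵ`, and «g ∈ 𝔏(Ě) in the sense of Eq. (52)» read as `g ∈ P q` — see READING (c)).
3. DEPTH. «ℓ ≫ q» (p.48 L26, p.49 L17–L19 `U49_3`; Lem. 9.5 p.50 L10–L11 «ℓ > |α + pβ + qγ₀|»): fields `q_lt_depth`, `degree_lt_depth`.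
4. CLEANING. «ϵ(0) is g-cleaned and hence … ∂(ϵ(0)) = ∂(g(0))» (Rem. 9.9 p.51 L10–L11; Eq. (75) p.48 L39): the two identities for
   `∂^{(α+pβ)}`, `∂^{(qγ₀)}` — the OPERATIVE content of the a-priori g-cleaning (§9.5.1) that the `H♭`-calculus uses (fields `clean₁/₂`);
   the cleaning PROCESS (Cor. 7.20, rows 045–046; row 055's three readings of «applicable») is not demanded — READING (b).
5. PLACEMENT. The completion `K'[[x]] = MvPowerSeries (Fin n) K'` of the local ring at a closed point, `K'` a PERFECT field of
   characteristic `p` (the coefficient field `K ⊇ 𝕂`, p.45 l.3 / Def. 3.3 p.8; 𝕂 perfect, §1 p.3) that is a `K`-algebra, with a guarded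
   ℘-filtration `P` (`Campaign.IsCharFiltration`, V3 guard C2), and the case witness `c` of Lem. 9.6 (row 057 `HFlat.Case`; no
   tie-break in print, p.51 L1–L2 — every applicable case is admitted, as in `F33`).
READINGS RECORDED (no side taken): (a) `ord_ξ` = tree `Resolution.adicOrder` on the local ring `K'[[x]]`; (b) see 4.; (c) «g ∈ 𝔏(Ě,q)»
(Prop. 9.1 p.47 L3, Th. 9.2 L22) is proxied by `g ∈ P q` (`𝔏(E,q) ⊆ ℘(E,q)`, Def. 6.12 p.33) TOGETHER WITH §8.3 (1) (`g = y^q + ϵ`,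
`ord ϵ > q`, `y ∈ x`): the datum does not know `Ě`'s cotangent flag `L(Ě)`, so «y is an `L(Ě)`-coordinate» is not expressible here
— an ENLARGEMENT of the admitted heads, recorded for the lanes; (d) `x` is the variable frame of the completion (Cohen / Def. 3.3
`TaylorFrame`), not an arbitrary regular system of parameters of `K'[[x]]`.
-/

noncomputable section

set_option linter.dupNamespace false -- mandated namespace of this single-conjunct summit

namespace Summit.ResolutionOfSingularities.ResolutionOfSingularities.Theorems.Campaign.PnegaObligation

open Literature.AlgebraicGeometry.Hironaka2017 Literature.AlgebraicGeometry.Hironaka2017.S09LLUED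
open Literature.AlgebraicGeometry.Hironaka2017.S08UnitMonomial (StandardExpression U46_3_ours)
open Literature.RingTheory.MvPowerSeries (hasseDeriv)

universe u v

/-! ## §1 The page's `H♭`-datum at a completion placement -/

section Datum

variable (p : ℕ) (K' : Type v) [Field K'] (n : ℕ)

/-- «The symbol ∂^X denotes the elementary differential operator of multi-index X with respect to a fixed parameters x in the
sense of Eq.(8)» (p.50 L17–L19): on the completion `K'[[x]]` the family `X ↦ ∂^{(X)}` of divided-power (Hasse) partial derivatives
of the variable frame — row 055's reading `U50_3`, tree `Literature.RingTheory.MvPowerSeries.hasseDeriv` (`coeff_β ∂^{(X)} f =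
C(X+β, X) coeff_{X+β} f`; on monomials Eq. (8) p.9). The EXACT operator family of the frame, in the shape `HFlat.op` consumes
(row 057 binder `D`). [folklore] -/
def hasseFamily : (Fin n →₀ ℕ) → MvPowerSeries (Fin n) K' → MvPowerSeries (Fin n) K' :=
  fun X => ⇑(hasseDeriv (A := K') (τ := Fin n) X)

variable (P : ℕ → Ideal (MvPowerSeries (Fin n) K'))

/-- [OURS · packaging of PRINTED data, no claim] An `H♭`-DATUM at the completion placement `(K'[[x]], P)`: everything §9.3–§9.7
(pp.48–51) fixes before `H♭(ϵ(0))` is evaluated, each field with its locator. `x` = the variables `MvPowerSeries.X` of `K'[[x]]`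
(reading (d)); `q = p^e`. EXISTENCE of such data for a given head is NOT asserted (that is rows 050/052a `U46_4`, 053a `U48_2`,
045–046/055 — candidate claims). [folklore] -/
structure HFlatDatum where
  /-- `e` of «q = p^e» (p.48 L26; row 053a `Setup93.e`) -/
  e : ℕ
  /-- «ℓ ≫ e > 0» (p.48 L26; `Setup93.e_pos`) -/
  e_pos : 0 < e
  /-- the depth `ℓ` of the standard expression / of the cleaning (p.48 L26–L36 «depth ℓ ≫ q … enlarge the depth number ℓ») -/
  depth : ℕ
  /-- the index of `y` in `x` («x ∋ y», p.48 L26; `Setup93.iy`) -/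
  i₀ : Fin n
  /-- the head `g = y^q + ϵ` (Prop. 9.1 p.47 L3; Th. 9.2 p.47 L22) -/
  g : MvPowerSeries (Fin n) K'
  /-- `ϵ(0)`, the g-cleaned `ϵ` (p.50 L7–L8 «The result is called ϵ(0) = ϵ♯(ℓ)») -/
  ε0 : MvPowerSeries (Fin n) K'
  /-- a standard expression of `ϵ(0)` in terms of `x` of depth `ℓ` (§8.4 p.46 l.29–38, row 052a; displayed as Eq. (76) p.49 L4–L12) -/
  S : StandardExpression p (MvPowerSeries.X : Fin n → MvPowerSeries (Fin n) K') e depth ε0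
  /-- §8.3 (1)–(2) p.46 l.18–28 in the OURS form of row 052a (`y ∈ x`, `y^q = g − ϵ`, `ord g = q = p^e < ord ϵ`, «g ∈ 𝔏(Ě)» read
  as `g ∈ P q` — reading (c)) for `(g, ϵ(0), y = x_{i₀})` -/
  std : U46_3_ours p (MvPowerSeries.X : Fin n → MvPowerSeries (Fin n) K') (fun f => f ∈ P (p ^ e)) e g ε0
    (MvPowerSeries.X i₀)
  /-- «m + 1 is the length of those with u_j ≠ 0» (§9.4 (3) p.49 L24): the top block is non-empty, so `γ₀` exists -/
  frontier_pos : 0 < TopFrontier.frontierLength S.support S.u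
  /-- (76)(2) p.49 L15 «u₀ is a unit» (row 053 `Eq76_2`, first conjunct; `u₀ = StdExpr76.u0`) -/
  u0_isUnit : IsUnit (StdExpr76.u0 S.support S.u)
  /-- (76)(2) p.49 L15 «and α ≠ (0)» (row 053 `Eq76_2`, second conjunct) -/
  alpha_ne_zero : TopFrontier.alpha S.support S.u ≠ 0
  /-- «ℓ ≫ q» (p.48 L26/L31; Lem. 9.5 p.50 L10 «We choose ℓ ≫ q») read as `q < ℓ` (row 055 `Lem9_5`, first clause) -/
  q_lt_depth : p ^ e < depth
  /-- Lem. 9.5 p.50 L10 «and in particular ℓ > |α + pβ + qγ₀|» (row 055 `Lem9_5`, second clause); with p.49 L17–L19 `U49_3` «so that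
  all the differentiations ∂ used for H♭ shall annihilate ρ^ℓ(O_ξ)» (for Hasse derivatives: orders `< ℓ ≤ p^ℓ`) -/
  degree_lt_depth : (TopFrontier.alpha S.support S.u + p • TopFrontier.beta S.support S.u +
      (p ^ e) • TopFrontier.gamma S.support S.u ⟨0, frontier_pos⟩).degree < depth
  /-- Rem. 9.9 p.51 L10–L11 «ϵ(0) is g-cleaned and hence … ∂(ϵ(0)) = ∂(g(0))» for `∂ = ∂^{(α+pβ)}` (Eq. (75) p.48 L39; reading (b)) -/
  clean₁ : hasseDeriv (TopFrontier.alpha S.support S.u + p • TopFrontier.beta S.support S.u) ε0 =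
      hasseDeriv (TopFrontier.alpha S.support S.u + p • TopFrontier.beta S.support S.u) g
  /-- the same for `∂ = ∂^{(qγ₀)}` (Rem. 9.9 p.51 L10–L11; Cor. 7.20 p.42 «∂^{(qγ)} g = ∂^{(qγ)} ϵ») -/
  clean₂ : hasseDeriv ((p ^ e) • TopFrontier.gamma S.support S.u ⟨0, frontier_pos⟩) ε0 =
      hasseDeriv ((p ^ e) • TopFrontier.gamma S.support S.u ⟨0, frontier_pos⟩) g
  /-- the case of Lem. 9.6 (p.50 L21–L23) in which `H♭` is evaluated («We choose H♭ in each of the three cases», p.51 L1–L2; row 057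
  `HFlat.Case` — a witness, no tie-break in print) -/
  case : HFlat.Case p (p ^ e) (TopFrontier.alpha S.support S.u) (TopFrontier.beta S.support S.u)
      (TopFrontier.gamma S.support S.u ⟨0, frontier_pos⟩)

namespace HFlatDatum

variable {p K' n P} (d : HFlatDatum p K' n P)

/-- `q = p^e` (p.48 L26). [folklore] -/
abbrev q : ℕ := p ^ d.e

/-- `α` of Eq. (76) (p.49 L4; row 054 `TopFrontier.alpha`). [folklore] -/
abbrev α : Fin n →₀ ℕ := TopFrontier.alpha d.S.support d.S.u

/-- `β` of Eq. (76) (p.49 L4; row 054 `TopFrontier.beta`). [folklore] -/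
abbrev β : Fin n →₀ ℕ := TopFrontier.beta d.S.support d.S.u

/-- `γ₀` of Eq. (76)/(77) (p.49 L4, L33; row 054 `TopFrontier.gamma … 0`). [folklore] -/
abbrev γ₀ : Fin n →₀ ℕ := TopFrontier.gamma d.S.support d.S.u ⟨0, d.frontier_pos⟩

/-- `u₀` of Eq. (76) as a unit (p.49 L11 «u₀ is a unit in ρ^ℓ(O_ξ)», (76)(2) L15; row 053 `StdExpr76.u0`). [folklore] -/
abbrev u₀ : (MvPowerSeries (Fin n) K')ˣ := d.u0_isUnit.unit

/-- `y = x_{i₀}` («x ∋ y», p.48 L26). [folklore] -/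
abbrev y : MvPowerSeries (Fin n) K' := MvPowerSeries.X d.i₀

/-- **`H♭(ϵ(0))`** of the datum: row 057's `HFlat.op` (Def. 9.12 p.51; Rem. 9.9 L3 / 9.10 L12 / 9.11 (7) L27 by case) evaluated with
the EXACT Hasse family of the frame and the exponents/unit read off the standard expression. [folklore] -/
def value : MvPowerSeries (Fin n) K' :=
  HFlat.op MvPowerSeries.X (hasseFamily K' n) d.u₀ p d.q d.α d.β d.γ₀ d.case d.ε0

/-- The homogeneity degree the page attaches to `H♭(ϵ(0))` (row 057 `HFlat.negDelta`: Rem. 9.9 (2) L7, 9.10 (2) L15, 9.11 (8) L29).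
[folklore] -/
def degree : ℤ :=
  HFlat.negDelta p d.q d.α d.β d.γ₀ d.case

end HFlatDatum

end Datum

/-! ## §2 The retyped obligation -/

/-- [OURS · L1 G1 ℘nega-INTERFACE · obligation F3.3 RETYPED, DATA LEVEL] replaces the role of the §9 slot hypotheses
«`⊟(g,q) ⊆ ℘̃(Ě)`» / «`⊟(Ě) ⊂ ℘nega(Ě)`» (p.47 L1–L2, L7–L11; (83)(2) p.55 L3–L7; p.58 L7) for a CANDIDATE family `tilde`: at every
completion placement `K'[[x]]` (`K'` a perfect field of characteristic `p` and a `K`-algebra — the coefficient field of `Ô_ξ`, Def. 3.3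
p.8 / p.45 l.3; `x` its variables), for every guarded ℘-filtration `P` (`Campaign.IsCharFiltration`) and every `H♭`-datum `d` of the
page (`HFlatDatum`: head `g = y^q + ϵ(0) ∈ P q` with `y = x_{i₀}`, `ord g = q = p^e < ord ϵ(0)`; a standard expression (76) of `ϵ(0)`
of depth `ℓ ≫ q` with «u₀ a unit, α ≠ 0»; the two cleaning identities `∂ϵ(0) = ∂g(0)`; a case of Lem. 9.6), the value `H♭(ϵ(0))`
computed with the EXACT Hasse derivatives `∂^{(α+pβ)}`, `∂^{(qγ₀)}` of the frame (Rem. 9.9–9.11 / Def. 9.12 p.51) lies in the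
candidate's piece of the degree the page names (`−δ`: Rem. 9.9 (2) L7, 9.10 (2) L15, 9.11 (8) L29) whenever that degree is negative
(Def. 9.12 L31–L32 «homogeneity degrees < 0» taken as hypothesis, as in `F33`). Relative to `F33` (p489269): operators and
`(α, β, γ₀, u₀, x, y)` are no longer free binders (lane B res-L1-ref-b1 OURS-DESK #89; res-adj-8 part 2; res-D-plan-1 V4 RULING (5)) —
see the module docstring for the four ties and the recorded readings (a)–(d). NOT a statement of the manuscript. VACUITY: met by the
top candidate (`F33std_top`); the datum type is INHABITED with a non-zero value of negative degree (sibling `…F33StdKernel`: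
`K[[y,z]]`, `g = y^p + z^{p+1}`, Case (III), value `z^{p+1}`, degree `−1`), so the «⊥-bypass» fails it — a genuine demand. [folklore] -/
def F33std (K : Type u) [CommRing K] (p : ℕ)
    (tilde : ∀ {B : Type v} [CommRing B] [Algebra K B], (ℕ → Ideal B) → ℤ → AddSubgroup B) : Prop :=
  ∀ (K' : Type v) [Field K'] [Algebra K K'] [CharP K' p] [PerfectField K'] (n : ℕ)
    (P : ℕ → Ideal (MvPowerSeries (Fin n) K')), IsCharFiltration K P →
    ∀ d : HFlatDatum p K' n P, d.degree < 0 → d.value ∈ tilde P d.degree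

/-! ## §3 Derived slot `⊟(g,q)` of the page's data at one completion placement, and the consumer map (as p489269 §3) -/

section Slots

variable (p : ℕ) {K' : Type v} [Field K'] {n : ℕ} (P : ℕ → Ideal (MvPowerSeries (Fin n) K'))

/-- The DATA-LEVEL `⊟(g,q)` of the page at a completion placement (p.47 L9–L10 «The products of those diff-product operations will
fill up the set ⊟(g,q)»): the values `H♭(ϵ(0))` of all `H♭`-data with head `g`, `p^e = q` and NEGATIVE page-degree. OURS bookkeeping
(row 014 `Boxminus`: «EXISTENCE / CONSTRUCTION NOT SHOWN IN PRINT»). [folklore] -/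
def boxminusStd (g : MvPowerSeries (Fin n) K') (q : ℕ) : Set (MvPowerSeries (Fin n) K') :=
  {h | ∃ d : HFlatDatum p K' n P, d.g = g ∧ d.q = q ∧ d.degree < 0 ∧ h = d.value}

variable {p P} {K : Type u} [CommRing K] [Algebra K K'] [CharP K' p] [PerfectField K']
  {tilde : ∀ {B : Type v} [CommRing B] [Algebra K B], (ℕ → Ideal B) → ℤ → AddSubgroup B}

/-- **F33std ⇒ every `⊟`-value lies in the candidate's piece of its (negative) page-degree.** [folklore] -/
theorem mem_piece_of_mem_boxminusStd (hF : F33std K p tilde) (hP : IsCharFiltration K P)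
    {g : MvPowerSeries (Fin n) K'} {q : ℕ} {h : MvPowerSeries (Fin n) K'} (hh : h ∈ boxminusStd p P g q) :
    ∃ δ : ℤ, δ < 0 ∧ h ∈ tilde P δ := by
  obtain ⟨d, -, -, hneg, rfl⟩ := hh
  exact ⟨d.degree, hneg, hF K' n P hP d hneg⟩

/-- **F33std ⇒ `⊟(g,q) ⊆ ℘nega(Ě)` degree by degree** (p.47 L2, p.58 L7). [folklore] -/
theorem mem_negaPiece_of_mem_boxminusStd (hF : F33std K p tilde) (hP : IsCharFiltration K P)
    {g : MvPowerSeries (Fin n) K'} {q : ℕ} {h : MvPowerSeries (Fin n) K'} (hh : h ∈ boxminusStd p P g q) :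
    ∃ a : ℕ, 0 < a ∧ h ∈ tilde P (-(a : ℤ)) := by
  obtain ⟨δ, hδ, hmem⟩ := mem_piece_of_mem_boxminusStd hF hP hh
  refine ⟨δ.natAbs, by omega, ?_⟩
  have : (-(δ.natAbs : ℤ)) = δ := by omega
  rw [this]
  exact hmem

/-- **The S09 slot binder `hbox : ∀ g a, boxminus g a ⊆ pTilde`** (`Proofs/S09LLUED/Thm9p18d.lean` :: `PTildeChainClosure(_ours)_of_carriers`,
`Thm9_18_1_of_closure`, `LLChainData.h_mem_of_boxminus_subset(_ours)`) at `boxminus := boxminusStd`, `pTilde := tildeFlat (tilde P)`.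
[folklore] -/
theorem boxminusStd_subset_tildeFlat (hF : F33std K p tilde) (hP : IsCharFiltration K P) :
    ∀ (g : MvPowerSeries (Fin n) K') (q : ℕ), boxminusStd p P g q ⊆ (tildeFlat (tilde P) : Set _) := by
  intro g q h hh
  obtain ⟨δ, -, hmem⟩ := mem_piece_of_mem_boxminusStd hF hP hh
  exact mem_tildeFlat_of_mem hmem

/-- … inside the flattened `℘nega` (p.47 L2 «⊟(Ě) ⊂ ℘nega(Ě)»). [folklore] -/
theorem boxminusStd_subset_negaFlat (hF : F33std K p tilde) (hP : IsCharFiltration K P) :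
    ∀ (g : MvPowerSeries (Fin n) K') (q : ℕ), boxminusStd p P g q ⊆ (negaFlat (tilde P) : Set _) := by
  intro g q h hh
  obtain ⟨a, ha, hmem⟩ := mem_negaPiece_of_mem_boxminusStd hF hP hh
  exact le_negaFlat (tilde P) ha hmem

/-- **F33std ⇒ row 014's field `total_subset_negaSum`** for `⊟(Ě) := ⋃_{g,q} ⊟(g,q)`. [folklore] -/
theorem boxminusStd_subset_negaSum (hF : F33std K p tilde) (hP : IsCharFiltration K P) :
    ∀ (g : MvPowerSeries (Fin n) K') (q : ℕ), boxminusStd p P g q ⊆ negaSum _ (negaPieces (tilde P)) := by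
  intro g q h hh
  obtain ⟨a, ha, hmem⟩ := mem_negaPiece_of_mem_boxminusStd hF hP hh
  exact mem_negaSum_of_mem_negaPiece (tilde P) ha hmem

/-- **F33std ⇒ the row-014 STRUCTURE `Boxminus` of §9** (p.46 L36–p.47 L11; binder `B` of `Prop9_1_of` / `Prop9_1_V_of`) at the
completion placement: `total := ⋃ ⊟(g,q)`, `ofHead := boxminusStd`. [folklore] -/
def boxminusOfF33std (hF : F33std K p tilde) (hP : IsCharFiltration K P) :
    Boxminus (MvPowerSeries (Fin n) K') (negaPieces (tilde P)) where
  total := ⋃ g, ⋃ q : ℕ, boxminusStd p P g q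
  total_subset_negaSum := by
    intro h hh
    simp only [Set.mem_iUnion] at hh
    obtain ⟨g, q, hh⟩ := hh
    exact boxminusStd_subset_negaSum hF hP g q hh
  ofHead := boxminusStd p P
  ofHead_subset_total := fun g q h hh => Set.mem_iUnion.2 ⟨g, Set.mem_iUnion.2 ⟨q, hh⟩⟩

end Slots

/-! ## §4 Regression at data level -/

section Regression

variable (K : Type u) [CommRing K] (p : ℕ)

/-- The top candidate meets F33std (satisfiability). [folklore] -/
theorem F33std_top : F33std K p (fun {B} [CommRing B] [Algebra K B] (_ : ℕ → Ideal B) (_ : ℤ) => (⊤ : AddSubgroup B)) := by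
  intro K' _ _ _ _ n P _ d _
  exact AddSubgroup.mem_top _

/-- A candidate that is `⊥` in every negative degree at some completion placement meets F33std only if every `H♭`-datum of
negative degree there has value `0`. [folklore] -/
theorem F33std_forces_zero_of_neg_bot
    (tilde : ∀ {B : Type v} [CommRing B] [Algebra K B], (ℕ → Ideal B) → ℤ → AddSubgroup B)
    (hF : F33std K p tilde) {K' : Type v} [Field K'] [Algebra K K'] [CharP K' p] [PerfectField K'] {n : ℕ}
    (P : ℕ → Ideal (MvPowerSeries (Fin n) K')) (hP : IsCharFiltration K P)
    (hbot : ∀ δ : ℤ, δ < 0 → tilde P δ = ⊥) (d : HFlatDatum p K' n P) (hd : d.degree < 0) : d.value = 0 := by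
  have h : d.value ∈ tilde P d.degree := hF K' n P hP d hd
  rw [hbot _ hd] at h
  exact (AddSubgroup.mem_bot).1 h

end Regression

end Summit.ResolutionOfSingularities.ResolutionOfSingularities.Theorems.Campaign.PnegaObligation

/-! ## §5 Over the checklist of record: `PnegaInterfaceV3.F33std` -/

namespace Summit.ResolutionOfSingularities.ResolutionOfSingularities.Theorems.Campaign.PnegaInterfaceV3

universe u v

variable {K : Type u} [CommRing K] {p : ℕ} {prov : PnegaProvenance.{u, v} K}

/-- [OURS · L1 G1 ℘nega-INTERFACE · obligation F3.3 RETYPED over V3] `PnegaObligation.F33std K p I.tilde` for an inhabitant `I` of the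
checklist `PnegaInterfaceV3` (p487629): the page's `H♭`-values of negative degree lie in the candidate's piece of that degree at
every completion placement. NOT a structure field, NOT a statement of the manuscript, asserted of no candidate. [folklore] -/
def F33std (I : PnegaInterfaceV3 K p prov) : Prop :=
  PnegaObligation.F33std K p I.tilde

/-- Unfolding anchor (by `Iff.rfl`). [folklore] -/
theorem F33std_iff (I : PnegaInterfaceV3 K p prov) : I.F33std ↔ PnegaObligation.F33std K p I.tilde :=
  Iff.rfl

end Summit.ResolutionOfSingularities.ResolutionOfSingularities.Theorems.Campaign.PnegaInterfaceV3
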